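import Literature.Barriers.ABC.BakerMethodBoundsStewartTijdemanGenericProofs
import HarnessLib

/-!
# Proofs for `BakerMethodBounds`: the Stewart–Tijdeman door `(15, 0)` in maximally permissive form

`Literature/Barriers/ABC/BakerMethodBoundsStewartTijdemanLogRadProofs.lean` — sequel to
`BakerMethodBoundsStewartTijdemanGenericProofs.lean` (theorems only: no definition, no named fact).

That file proves `stewartTijdeman1986_of_primePadicBound`: the named fact
`stewartTijdeman1986_upperBound` (Stewart–Tijdeman 1986, `log c ≤ κ · rad(abc)^{15}` for every abc
triple [cite: StewartTijdeman1986, Theorem 1 (upper bound), as quoted in Waldschmidt2014 §2 (PDF p. 3)])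
follows from ANY `p`-adic lower bound for linear forms in the logarithms of distinct rational primes
of the shape `ord_p(q₁^{e₁}⋯qₙ^{eₙ} − 1) ≤ K Lⁿ n^{κn} p^σ (∏ log qᵢ) (log max(3, max|eᵢ|))^τ`
(`κ, σ ≤ 14`). The height dependence demanded there is the clean product `∏ log qᵢ` of
Baker–Wüstholz / Yu quality. The `p`-adic theorems provable by Baker's method with a Kummer descent
and one Schwarz lemma per step, WITHOUT multiplicity estimates on group varieties — the `p`-adic
analogue of Cijsouw–Waldschmidt 1977, Prop. 1 (cf. the archimedean
`Literature.NumberTheory.Transcendental.CW77.cw77_prop1_rat_hW₃`, proved in the tree), van der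
Poorten 1977, Yu 1989/1990 — carry extra factors `log Ω`, `log Ω'`, `log log A` (`Ω = ∏ log qᵢ`,
`A = max qᵢ`), e.g. `C(n) p^σ Ω log Ω (log B + log Ω)²` or Yu 1990's `p² log B log log A ∏ log qᵢ`
[cite: ShoreyTijdeman1986, Ch. B, Theorem B.3 (PDF p. 38 of the held copy)].

This file removes that obstruction: `stewartTijdeman1986_of_primePadicBound_logRad` accepts the
extra factor `(log max(3, q₁⋯qₙ))^{τ₁}` for any `τ₁ ∈ ℕ`, with the same admissible `κ, σ ∈ [0, 14]`.
Since `log Ω ≤ ∑ log qᵢ = log(q₁⋯qₙ)` and `log log A ≤ log(q₁⋯qₙ)`, every bound of the shapes above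
qualifies (after `Ω log Ω (log B + log Ω)^k ≤ 2^k Ω (log B')^k (log(3 q₁⋯qₙ))^{k+1}`-type bookkeeping on
the user's side). The proof is that of the generic file with the factor threaded through:
in the application the generators are the primes of `ab` (or of `bc`, `ca`), so
`q₁⋯qₙ = rad(yz) ≤ R` and `(log max(3, rad(yz)))^{τ₁} ≤ 3 (30(τ₁+1))^{τ₁} rad(yz)^{1/30}`
(`StewartTijdemanGeneric.log_pow_le_rpow`), which the exponent budget
`rad(yz)^{κ + 1/8 + 1/4 + 1/30} rad(x)^{σ + 1/8} ≤ R^{29/2}` (`κ, σ ≤ 14`) absorbs before the endgame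
`StewartTijdemanGeneric.bakerShapeBound_fifteen_of_loglog`.

Purpose (cell abc-stewartyu, 2026-08-25): this is the door through which a kernel proof of a CRUDE
`p`-adic Baker theorem for rational primes — constants `n^{O(n)}`, `p^{O(1)}`, any polylogarithms —
makes `stewartTijdeman1986_upperBound` the first machine-checked abc-type bound, without Yu 2007.

## Contents

* `sum_padicPart_le_logRad` — the Stewart–Tijdeman summation over the primes `p ≥ p₀` of one member,
  with the factor `(log max(3, rad(yz)))^{τ₁}` carried along;
* `sum_padicPart_le_rad_logRad` — one member against the radical: exponent `29/2`, constant
  `8 K 2^τ · 3(30(τ₁+1))^{τ₁} · A`;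
* `stewartTijdeman1986_of_primePadicBound_logRad` — the door.

## References

* [StewartTijdeman1986] C. L. Stewart, R. Tijdeman, *On the Oesterlé–Masser conjecture*,
  Monatsh. Math. 102 (1986), 251–257 — Theorem 1 (upper bound), as quoted in [Waldschmidt2014].
* [Waldschmidt2014] M. Waldschmidt, *Lecture on the abc conjecture and some of its consequences*,
  Springer Proc. Math. Stat. 98 (2015), §2 (PDF p. 3).
* [ShoreyTijdeman1986] T. N. Shorey, R. Tijdeman, *Exponential Diophantine Equations*, Cambridge
  Tracts in Math. 87, CUP 1986 — Ch. B, Theorems B.3–B.4 (van der Poorten's `p`-adic estimates).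
* [CijsouwWaldschmidt1977] P. L. Cijsouw, M. Waldschmidt, *Linear forms and simultaneous
  approximations*, Compositio Math. 34 (1977), 173–197 — Proposition 1 (p. 183).
-/

noncomputable section

open Finset Real Height
open Literature.NumberTheory.DiophantineGeometry
open Literature.NumberTheory.DiophantineGeometry.Dioph

namespace Literature.Barriers.ABC

namespace StewartTijdemanGeneric

/-! ### The summation over the primes of one member, with the radical-logarithm factor -/

/-- **The Stewart–Tijdeman summation, generic form with a radical-logarithm factor.** Copy of
`StewartTijdemanGeneric.sum_padicPart_le` in which the `p`-adic hypothesis carries the extra factor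
`(log max(3, ∏ qᵢ))^{τ₁}` (any polylogarithm of the product of the generators: it dominates `log Ω`,
`(log Ω)²`, `log log max qᵢ`, … for `Ω = ∏ log qᵢ`), which the conclusion carries as
`(log max(3, rad(yz)))^{τ₁}`. Let `y ≠ z` be coprime positive integers,
`S` the set of primes of `yz` (`n = #S`, `e_q = ord_q y − ord_q z`), and `x` a positive integer
coprime to `yz` with `x ∣ y² − z²` (for an abc triple: `x = c`, `{y, z} = {a, b}`, or `x = a`,
`{y, z} = {c, b}`, or `x = b`, `{y, z} = {c, a}`). Suppose that for every prime `p ≥ p₀` and every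
family of distinct primes `q₁, …, qₙ ≠ p` with exponents `e ≠ 0`,
`ord_p(q₁^{e₁}⋯qₙ^{eₙ} − 1) ≤ K Lⁿ n^{κn} p^σ (∏ log qᵢ) (log max(3, max |eᵢ|))^τ (log max(3, ∏ qᵢ))^{τ₁}`.
Then, applying
this at every prime `p ≥ p₀` of `x` to `(y/z)² − 1 = ∏_{q ∈ S} q^{2e_q} − 1` (whose `p`-order is
`≥ ord_p x`) and summing against `log p`:
`∑_{p ∣ x, p ≥ p₀} ord_p(x) log p ≤ K Lⁿ n^{κn} (∏_{q ∈ S} log q) (log max(3, 3 log max(y,z)))^τ ·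
(log max(3, ∏ S))^{τ₁} · ∑_{p ∣ x, p ≥ p₀} p^σ log p` — the summation step of the Stewart–Tijdeman
proof line (a `p`-adic bound at every prime of one member, summed against `log p`).
[cite: StewartTijdeman1986, Theorem 1 (proof), as quoted in Waldschmidt2014 §2 (PDF p. 3)] -/
theorem sum_padicPart_le_logRad {K L κ σ : ℝ} {τ τ₁ p₀ : ℕ} (hK : 0 ≤ K) (hL : 1 ≤ L)
    (hP : ∀ (p n : ℕ) (q : Fin n → ℕ) (e : Fin n → ℤ), p.Prime → p₀ ≤ p →
      (∀ i, (q i).Prime) → Function.Injective q → (∀ i, q i ≠ p) → e ≠ 0 →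
      ∏ i, ((q i : ℚ)) ^ e i ≠ 1 →
      (padicValRat p (∏ i, ((q i : ℚ)) ^ e i - 1) : ℝ) ≤
        K * L ^ n * (n : ℝ) ^ (κ * n) * (p : ℝ) ^ σ * (∏ i, Real.log (q i)) *
          Real.log (max 3 ((Finset.univ.sup fun i => (e i).natAbs : ℕ) : ℝ)) ^ τ *
          Real.log (max 3 (∏ i, ((q i : ℕ) : ℝ))) ^ τ₁)
    {x y z : ℕ} (hx : 0 < x) (hy : 0 < y) (hz : 0 < z) (hyz : y ≠ z) (hcop : Nat.Coprime y z)
    (hxcop : Nat.Coprime x (y * z)) (hdvd : (x : ℤ) ∣ (y : ℤ) ^ 2 - (z : ℤ) ^ 2) :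
    ∑ p ∈ x.primeFactors.filter (fun p => p₀ ≤ p), (x.factorization p : ℝ) * Real.log p ≤
      K * L ^ (y * z).primeFactors.card *
        ((y * z).primeFactors.card : ℝ) ^ (κ * (y * z).primeFactors.card) *
        (∏ q ∈ (y * z).primeFactors, Real.log q) *
        Real.log (max 3 (3 * Real.log (max y z : ℕ))) ^ τ *
        Real.log (max 3 ((((∏ q ∈ (y * z).primeFactors, q : ℕ)) : ℝ))) ^ τ₁ *
        ∑ p ∈ x.primeFactors.filter (fun p => p₀ ≤ p), (p : ℝ) ^ σ * Real.log p := by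
  classical
  have hy0 : y ≠ 0 := hy.ne'
  have hz0 : z ≠ 0 := hz.ne'
  have hx0 : x ≠ 0 := hx.ne'
  set S := (y * z).primeFactors with hS
  set n := S.card with hn
  have hprime : ∀ q ∈ S, q.Prime := fun q hq => Nat.prime_of_mem_primeFactors hq
  -- the exponent vector and the `Fin n`-indexed family of primes
  set e : ℕ → ℤ := fun q => (y.factorization q : ℤ) - (z.factorization q : ℤ) with he
  set φ : Fin n ≃ S := S.equivFin.symm with hφ
  set q : Fin n → ℕ := fun i => (φ i : ℕ) with hqdef
  set e' : Fin n → ℤ := fun i => 2 * e (q i) with he'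
  have hqS : ∀ i, q i ∈ S := fun i => (φ i).2
  have hqP : ∀ i, (q i).Prime := fun i => hprime _ (hqS i)
  have hinj : Function.Injective q := fun i j hij =>
    φ.injective (Subtype.ext hij)
  -- `S` is nonempty and every `e_q`, `q ∈ S`, is non-zero
  have hyz1 : 1 < y * z := by
    rcases Nat.lt_or_ge 1 y with h | h
    · nlinarith
    · have hy1 : y = 1 := by omega
      subst hy1
      have : 1 < z := by omega
      simpa using this
  have hSne : S.Nonempty := Nat.nonempty_primeFactors.mpr hyz1
  have hn0 : 0 < n := Finset.card_pos.mpr hSne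
  have he_ne : ∀ r ∈ S, e r ≠ 0 := by
    intro r hr
    have hrP := hprime r hr
    have hrdvd : r ∣ y * z := Nat.dvd_of_mem_primeFactors hr
    rcases (Nat.Prime.dvd_mul hrP).mp hrdvd with hry | hrz
    · have h1 : 0 < y.factorization r := hrP.factorization_pos_of_dvd hy0 hry
      have h2 : z.factorization r = 0 := by
        apply Nat.factorization_eq_zero_of_not_dvd
        intro hrz
        exact hrP.one_lt.ne' (Nat.eq_one_of_dvd_coprimes hcop hry hrz)
      simp only [he, h2]; omega
    · have h1 : 0 < z.factorization r := hrP.factorization_pos_of_dvd hz0 hrz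
      have h2 : y.factorization r = 0 := by
        apply Nat.factorization_eq_zero_of_not_dvd
        intro hry
        exact hrP.one_lt.ne' (Nat.eq_one_of_dvd_coprimes hcop hry hrz)
      simp only [he, h2]; omega
  have he'ne : e' ≠ 0 := by
    intro h0
    obtain ⟨i⟩ : Nonempty (Fin n) := ⟨⟨0, hn0⟩⟩
    have := congr_fun h0 i
    simp only [he', Pi.zero_apply, mul_eq_zero, OfNat.ofNat_ne_zero, false_or] at this
    exact he_ne _ (hqS i) this
  -- `∏ q_i^{e'_i} = (y/z)²`
  have hfac : ∀ {m : ℕ}, m ≠ 0 → m ∣ y * z →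
      (m : ℚ) = ∏ r ∈ S, (r : ℚ) ^ m.factorization r := by
    intro m hm hmd
    have h1 := Nat.prod_primeFactors_pow_factorization hm
    have hsub : m.primeFactors ⊆ S := Nat.primeFactors_mono hmd (mul_ne_zero hy0 hz0)
    rw [← Finset.prod_subset hsub (fun r hrS hr => ?_)]
    · exact_mod_cast h1
    · have hnd : ¬ r ∣ m := fun hd => hr (Nat.mem_primeFactors.mpr ⟨hprime r hrS, hd, hm⟩)
      rw [Nat.factorization_eq_zero_of_not_dvd hnd, pow_zero]
  have hprodS : ∏ r ∈ S, (r : ℚ) ^ e r = (y : ℚ) / z := by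
    rw [hfac hy0 (dvd_mul_right y z), hfac hz0 (dvd_mul_left z y), ← Finset.prod_div_distrib]
    refine Finset.prod_congr rfl fun r hr => ?_
    have hr0 : (r : ℚ) ≠ 0 := by exact_mod_cast (hprime r hr).ne_zero
    rw [he, zpow_sub₀ hr0, zpow_natCast, zpow_natCast]
  have hprod : ∏ i, ((q i : ℚ)) ^ e' i = ((y : ℚ) / z) ^ 2 := by
    have h1 : ∏ i, ((q i : ℚ)) ^ e' i = ∏ i, (((q i : ℚ)) ^ e (q i)) ^ 2 := by
      refine Finset.prod_congr rfl fun i _ => ?_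
      show ((q i : ℚ)) ^ (2 * e (q i)) = (((q i : ℚ)) ^ e (q i)) ^ 2
      rw [mul_comm, zpow_mul, zpow_ofNat]
    have h2 : ∏ i, (((q i : ℚ)) ^ e (q i)) ^ 2 = (∏ i, ((q i : ℚ)) ^ e (q i)) ^ 2 :=
      Finset.prod_pow _ 2 _
    have h3 : ∏ i, ((q i : ℚ)) ^ e (q i) = ∏ r ∈ S, (r : ℚ) ^ e r := by
      rw [← Finset.prod_coe_sort S (fun r => (r : ℚ) ^ e r)]
      exact Fintype.prod_equiv φ (fun i => ((q i : ℚ)) ^ e (q i)) (fun r => ((r : ℕ) : ℚ) ^ e r)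
        (fun i => rfl)
    rw [h1, h2, h3, hprodS]
  have hyzQ : (y : ℚ) / z ≠ 1 := by
    intro h
    rw [div_eq_one_iff_eq (by exact_mod_cast hz0)] at h
    exact hyz (by exact_mod_cast h)
  have hyzQ' : (y : ℚ) / z ≠ -1 := by
    intro h
    have : (0 : ℚ) < (y : ℚ) / z := div_pos (by exact_mod_cast hy) (by exact_mod_cast hz)
    rw [h] at this; norm_num at this
  have hne1 : ∏ i, ((q i : ℚ)) ^ e' i ≠ 1 := by
    rw [hprod]
    intro h
    rcases sq_eq_one_iff.mp h with h1 | h1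
    · exact hyzQ h1
    · exact hyzQ' h1
  -- the integer `m = y² − z² ≠ 0` and `(y/z)² − 1 = m / z²`
  set m : ℤ := (y : ℤ) ^ 2 - (z : ℤ) ^ 2 with hm
  have hm0 : m ≠ 0 := by
    intro h
    have h' : ((y : ℤ)) ^ 2 = (z : ℤ) ^ 2 := sub_eq_zero.mp h
    have h'' : y ^ 2 = z ^ 2 := by exact_mod_cast h'
    exact hyz (Nat.pow_left_injective (by norm_num) h'')
  have hΛ : ∏ i, ((q i : ℚ)) ^ e' i - 1 = (m : ℚ) / ((z : ℚ)) ^ 2 := by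
    rw [hprod, hm]; push_cast
    field_simp
  -- heights and the sup of the exponents
  have hΘ : ∏ i, Real.log (q i) = ∏ r ∈ S, Real.log r := by
    rw [← Finset.prod_coe_sort S (fun r => Real.log r)]
    exact Fintype.prod_equiv φ (fun i => Real.log (q i)) (fun r => Real.log ((r : ℕ) : ℝ))
      (fun i => rfl)
  have hPr : ∏ i, ((q i : ℕ) : ℝ) = ((((∏ r ∈ S, r : ℕ)) : ℝ)) := by
    rw [Nat.cast_prod, ← Finset.prod_coe_sort S (fun r => ((r : ℕ) : ℝ))]
    exact Fintype.prod_equiv φ (fun i => ((q i : ℕ) : ℝ)) (fun r => ((r : ℕ) : ℝ)) (fun i => rfl)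
  set Ψ : ℝ := Real.log (max 3 ((((∏ r ∈ S, r : ℕ)) : ℝ))) ^ τ₁ with hΨ
  have hΨ0 : 0 ≤ Ψ := pow_nonneg (Real.log_nonneg (le_trans (by norm_num) (le_max_left _ _))) τ₁
  have hl2 : 0.6931471803 < Real.log 2 := Real.log_two_gt_d9
  have hmax1 : (1 : ℝ) ≤ (max y z : ℕ) := by exact_mod_cast (show 1 ≤ max y z from le_max_of_le_left hy)
  have hlogmax0 : 0 ≤ Real.log (max y z : ℕ) := Real.log_nonneg hmax1
  have hsup : (((Finset.univ.sup fun i => (e' i).natAbs : ℕ)) : ℝ) ≤ 3 * Real.log (max y z : ℕ) := by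
    obtain ⟨i, -, hi⟩ := Finset.exists_mem_eq_sup (Finset.univ : Finset (Fin n))
      (Finset.univ_nonempty_iff.mpr ⟨⟨0, hn0⟩⟩) (fun i => (e' i).natAbs)
    rw [hi]
    have hfy := factorization_mul_log_two_le (q := q i) (hqP i) hy0
    have hfz := factorization_mul_log_two_le (q := q i) (hqP i) hz0
    have hly : Real.log y ≤ Real.log (max y z : ℕ) :=
      Real.log_le_log (by exact_mod_cast hy) (by exact_mod_cast le_max_left y z)
    have hlz : Real.log z ≤ Real.log (max y z : ℕ) :=
      Real.log_le_log (by exact_mod_cast hz) (by exact_mod_cast le_max_right y z)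
    have hyf0 : (0 : ℝ) ≤ y.factorization (q i) := Nat.cast_nonneg _
    have hzf0 : (0 : ℝ) ≤ z.factorization (q i) := Nat.cast_nonneg _
    have hpy := mul_nonneg hyf0 (sub_nonneg.mpr hl2.le)
    have hpz := mul_nonneg hzf0 (sub_nonneg.mpr hl2.le)
    rcases le_total (y.factorization (q i)) (z.factorization (q i)) with h | h
    · have h1 : (e' i).natAbs ≤ 2 * z.factorization (q i) := by
        simp only [he', he]; omega
      have h1' : ((e' i).natAbs : ℝ) ≤ 2 * (z.factorization (q i) : ℝ) := by exact_mod_cast h1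
      linarith
    · have h1 : (e' i).natAbs ≤ 2 * y.factorization (q i) := by
        simp only [he', he]; omega
      have h1' : ((e' i).natAbs : ℝ) ≤ 2 * (y.factorization (q i) : ℝ) := by exact_mod_cast h1
      linarith
  -- the per-prime estimate
  set T := x.primeFactors.filter (fun p => p₀ ≤ p) with hT
  have hterm : ∀ p ∈ T, (x.factorization p : ℝ) * Real.log p ≤
      K * L ^ n * (n : ℝ) ^ (κ * n) * (∏ r ∈ S, Real.log r) *
        Real.log (max 3 (3 * Real.log (max y z : ℕ))) ^ τ * Ψ * ((p : ℝ) ^ σ * Real.log p) := by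
    intro p hp
    obtain ⟨hpx, hp₀⟩ := Finset.mem_filter.mp hp
    have hpP : p.Prime := Nat.prime_of_mem_primeFactors hpx
    haveI : Fact p.Prime := ⟨hpP⟩
    have hpdx : p ∣ x := Nat.dvd_of_mem_primeFactors hpx
    have hpyz : ¬ p ∣ y * z := fun hd =>
      hpP.one_lt.ne' (Nat.eq_one_of_dvd_coprimes hxcop hpdx hd)
    have hpz : ¬ p ∣ z := fun hd => hpyz (dvd_mul_of_dvd_right hd y)
    have hqp : ∀ i, q i ≠ p := fun i h => hpyz (h ▸ Nat.dvd_of_mem_primeFactors (hqS i))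
    -- `ord_p x ≤ ord_p ((y/z)² − 1)`
    have hval : (x.factorization p : ℤ) ≤ padicValRat p (∏ i, ((q i : ℚ)) ^ e' i - 1) := by
      rw [hΛ, padicValRat.div (by exact_mod_cast hm0) (pow_ne_zero 2 (by exact_mod_cast hz0)),
        padicValRat.pow, padicValRat.of_nat, padicValNat.eq_zero_of_not_dvd hpz]
      simp only [Nat.cast_zero, mul_zero, sub_zero]
      rw [padicValRat.of_int]
      have hdvd' : (p : ℤ) ^ x.factorization p ∣ m :=
        dvd_trans (by exact_mod_cast Nat.ordProj_dvd x p) hdvd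
      have := (padicValInt_dvd_iff _ _).mp hdvd'
      rcases this with h | h
      · exact absurd h hm0
      · exact_mod_cast h
    have hval' : (x.factorization p : ℝ) ≤ (padicValRat p (∏ i, ((q i : ℚ)) ^ e' i - 1) : ℝ) := by
      exact_mod_cast hval
    have key := hP p n q e' hpP hp₀ hqP hinj hqp he'ne hne1
    rw [hΘ, hPr] at key
    have hlogp : 0 ≤ Real.log p := Real.log_nonneg (by exact_mod_cast hpP.one_lt.le)
    have hpre : 0 ≤ K * L ^ n * (n : ℝ) ^ (κ * n) * (p : ℝ) ^ σ * (∏ r ∈ S, Real.log r) := by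
      have hΘ0 : 0 ≤ ∏ r ∈ S, Real.log r := Finset.prod_nonneg fun r hr =>
        Real.log_nonneg (by exact_mod_cast (hprime r hr).one_lt.le)
      have : 0 ≤ L ^ n := pow_nonneg (zero_le_one.trans hL) n
      positivity
    have hlog3 : 0 ≤ Real.log (max 3 (((Finset.univ.sup fun i => (e' i).natAbs : ℕ)) : ℝ)) :=
      Real.log_nonneg (le_trans (by norm_num) (le_max_left _ _))
    have hmono : Real.log (max 3 (((Finset.univ.sup fun i => (e' i).natAbs : ℕ)) : ℝ)) ^ τ ≤
        Real.log (max 3 (3 * Real.log (max y z : ℕ))) ^ τ := by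
      apply pow_le_pow_left₀ hlog3
      apply Real.log_le_log (lt_of_lt_of_le (by norm_num) (le_max_left _ _))
      exact max_le_max le_rfl hsup
    calc (x.factorization p : ℝ) * Real.log p
        ≤ (K * L ^ n * (n : ℝ) ^ (κ * n) * (p : ℝ) ^ σ * (∏ r ∈ S, Real.log r) *
            Real.log (max 3 (((Finset.univ.sup fun i => (e' i).natAbs : ℕ)) : ℝ)) ^ τ * Ψ) *
            Real.log p := mul_le_mul_of_nonneg_right (hval'.trans key) hlogp
      _ ≤ (K * L ^ n * (n : ℝ) ^ (κ * n) * (p : ℝ) ^ σ * (∏ r ∈ S, Real.log r) *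
            Real.log (max 3 (3 * Real.log (max y z : ℕ))) ^ τ * Ψ) * Real.log p :=
          mul_le_mul_of_nonneg_right
            (mul_le_mul_of_nonneg_right (mul_le_mul_of_nonneg_left hmono hpre) hΨ0) hlogp
      _ = _ := by ring
  calc ∑ p ∈ T, (x.factorization p : ℝ) * Real.log p
      ≤ ∑ p ∈ T, K * L ^ n * (n : ℝ) ^ (κ * n) * (∏ r ∈ S, Real.log r) *
          Real.log (max 3 (3 * Real.log (max y z : ℕ))) ^ τ * Ψ * ((p : ℝ) ^ σ * Real.log p) :=
        Finset.sum_le_sum hterm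
    _ = _ := by rw [← Finset.mul_sum]

/-! ### One member of the triple against the radical: exponent `29/2` -/

/-- **The bound for one member, against the radical.** In the situation of `sum_padicPart_le`,
with the admissible class of constants `κ, σ ∈ [0, 14]` and `A` such that
`(4 L e^κ)^{#S} ≤ A (∏ S)^{1/8}` for all finite sets of primes `S`
(`exists_pow_card_le_prod_rpow`):
`∑_{p ∣ x, p ≥ p₀} ord_p(x) log p ≤ 8 K 2^τ · 3(30(τ₁+1))^{τ₁} · A · rad(xyz)^{29/2} · (log max(3, log max(y, z)))^τ`.
Book-keeping: `n^{κn} ≤ e^{κn} (n!)^κ ≤ e^{κn} rad(yz)^κ` (`(#S)! ≤ ∏ S`),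
`∏_{q ∣ yz} log q ≤ 4ⁿ rad(yz)^{1/4}`, `∑_{p ∣ x} p^σ log p ≤ rad(x)^σ log rad(x) ≤ 8 rad(x)^{σ+1/8}`,
`Lⁿ e^{κn} 4ⁿ ≤ A rad(yz)^{1/8}`, `(log max(3, rad(yz)))^{τ₁} ≤ 3 (30(τ₁+1))^{τ₁} rad(yz)^{1/30}`
(`log_pow_le_rpow`), and `rad(yz)^{κ+1/8+1/4+1/30} rad(x)^{σ+1/8} ≤ rad(xyz)^{29/2}` — the comparison
with the radical in the Stewart–Tijdeman proof line.
[cite: StewartTijdeman1986, Theorem 1 (proof), as quoted in Waldschmidt2014 §2 (PDF p. 3)] -/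

theorem sum_padicPart_le_rad_logRad {K L κ σ : ℝ} {τ τ₁ p₀ : ℕ} (hK : 0 ≤ K) (hL : 1 ≤ L) (hκ0 : 0 ≤ κ)
    (hκ : κ ≤ 14) (hσ0 : 0 ≤ σ) (hσ : σ ≤ 14)
    (hP : ∀ (p n : ℕ) (q : Fin n → ℕ) (e : Fin n → ℤ), p.Prime → p₀ ≤ p →
      (∀ i, (q i).Prime) → Function.Injective q → (∀ i, q i ≠ p) → e ≠ 0 →
      ∏ i, ((q i : ℚ)) ^ e i ≠ 1 →
      (padicValRat p (∏ i, ((q i : ℚ)) ^ e i - 1) : ℝ) ≤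
        K * L ^ n * (n : ℝ) ^ (κ * n) * (p : ℝ) ^ σ * (∏ i, Real.log (q i)) *
          Real.log (max 3 ((Finset.univ.sup fun i => (e i).natAbs : ℕ) : ℝ)) ^ τ *
          Real.log (max 3 (∏ i, ((q i : ℕ) : ℝ))) ^ τ₁)
    {A : ℝ} (hA0 : 0 ≤ A)
    (hA : ∀ S : Finset ℕ, (∀ q ∈ S, q.Prime) →
      (4 * L * Real.exp κ) ^ S.card ≤ A * (((∏ q ∈ S, q : ℕ)) : ℝ) ^ (1 / 8 : ℝ))
    {x y z : ℕ} (hx : 0 < x) (hy : 0 < y) (hz : 0 < z) (hyz : y ≠ z) (hcop : Nat.Coprime y z)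
    (hxcop : Nat.Coprime x (y * z)) (hdvd : (x : ℤ) ∣ (y : ℤ) ^ 2 - (z : ℤ) ^ 2) :
    ∑ p ∈ x.primeFactors.filter (fun p => p₀ ≤ p), (x.factorization p : ℝ) * Real.log p ≤
      8 * K * 2 ^ τ * (3 * (30 * ((τ₁ : ℝ) + 1)) ^ τ₁) * A *
        (((∏ q ∈ (x * (y * z)).primeFactors, q : ℕ)) : ℝ) ^ (29 / 2 : ℝ) *
        Real.log (max 3 (Real.log (max y z : ℕ))) ^ τ := by
  classical
  have hsum := sum_padicPart_le_logRad (p₀ := p₀) hK hL hP hx hy hz hyz hcop hxcop hdvd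
  have hx0 : x ≠ 0 := hx.ne'
  have hy0 : y ≠ 0 := hy.ne'
  have hz0 : z ≠ 0 := hz.ne'
  set S := (y * z).primeFactors with hS
  set n := S.card with hn
  set T := x.primeFactors.filter (fun p => p₀ ≤ p) with hT
  set P₁ : ℝ := (((∏ q ∈ S, q : ℕ)) : ℝ) with hP₁
  set Px : ℝ := (((∏ p ∈ x.primeFactors, p : ℕ)) : ℝ) with hPx
  set P₂ : ℝ := (((∏ p ∈ T, p : ℕ)) : ℝ) with hP₂
  set Θ : ℝ := ∏ q ∈ S, Real.log q with hΘ
  set W : ℝ := Real.log (max 3 (Real.log (max y z : ℕ))) with hW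
  set Φ : ℝ := Real.log (max 3 (3 * Real.log (max y z : ℕ))) ^ τ with hΦ
  set Sg : ℝ := ∑ p ∈ T, (p : ℝ) ^ σ * Real.log p with hSg
  set Ψ : ℝ := Real.log (max 3 P₁) ^ τ₁ with hΨ
  set C₁ : ℝ := 3 * (30 * ((τ₁ : ℝ) + 1)) ^ τ₁ with hC₁
  have hprimeS : ∀ q ∈ S, q.Prime := fun q hq => Nat.prime_of_mem_primeFactors hq
  have hprimeX : ∀ p ∈ x.primeFactors, p.Prime := fun p hp => Nat.prime_of_mem_primeFactors hp
  have hprimeT : ∀ p ∈ T, p.Prime := fun p hp => hprimeX p (Finset.mem_filter.mp hp).1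
  have hP₁1 : 1 ≤ P₁ := by
    rw [hP₁]; exact_mod_cast Finset.prod_pos fun q hq => (hprimeS q hq).pos
  have hPx1 : 1 ≤ Px := by
    rw [hPx]; exact_mod_cast Finset.prod_pos fun p hp => (hprimeX p hp).pos
  have hP₂1 : 1 ≤ P₂ := by
    rw [hP₂]; exact_mod_cast Finset.prod_pos fun p hp => (hprimeT p hp).pos
  have hP₂x : P₂ ≤ Px := by
    rw [hP₂, hPx]
    exact_mod_cast Finset.prod_le_prod_of_subset_of_one_le' (Finset.filter_subset _ _)
      fun p hp _ => (hprimeX p hp).one_lt.le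
  -- the radical of `xyz`
  have hRad : (((∏ q ∈ (x * (y * z)).primeFactors, q : ℕ)) : ℝ) = Px * P₁ := by
    rw [hPx, hP₁, hS, Nat.Coprime.primeFactors_mul hxcop,
      Finset.prod_union hxcop.disjoint_primeFactors]
    push_cast; ring
  -- (1) `n^{κn} ≤ (e^κ)ⁿ P₁^κ`
  have hfact : ((n.factorial : ℕ) : ℝ) ≤ P₁ := by
    rw [hP₁]
    exact_mod_cast factorial_card_le_prod n S hn.symm fun q hq => (hprimeS q hq).one_lt.le
  have h1 : (n : ℝ) ^ (κ * n) ≤ Real.exp κ ^ n * P₁ ^ κ :=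
    (rpow_mul_self_le hκ0 n).trans
      (mul_le_mul_of_nonneg_left (Real.rpow_le_rpow (Nat.cast_nonneg _) hfact hκ0)
        (pow_nonneg (Real.exp_pos κ).le n))
  -- (2) `Θ ≤ 4ⁿ P₁^{1/4}`
  have h2 : Θ ≤ 4 ^ n * P₁ ^ (1 / 4 : ℝ) := by
    have h := prod_log_le_pow_mul_prod_rpow hprimeS (θ := 1 / 4) (by norm_num)
    rw [one_div_one_div] at h
    exact h
  -- (3) `Sg ≤ 8 P₂^σ P₂^{1/8}`
  have h3 : Sg ≤ 8 * (P₂ ^ σ * P₂ ^ (1 / 8 : ℝ)) := by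
    have h := sum_rpow_mul_log_le hprimeT hσ0
    have hlog : Real.log P₂ ≤ P₂ ^ (1 / 8 : ℝ) / (1 / 8) :=
      Real.log_le_rpow_div (zero_le_one.trans hP₂1) (by norm_num)
    calc Sg ≤ P₂ ^ σ * Real.log P₂ := h
      _ ≤ P₂ ^ σ * (P₂ ^ (1 / 8 : ℝ) / (1 / 8)) :=
          mul_le_mul_of_nonneg_left hlog (Real.rpow_nonneg (zero_le_one.trans hP₂1) σ)
      _ = 8 * (P₂ ^ σ * P₂ ^ (1 / 8 : ℝ)) := by ring
  -- (4) `Φ ≤ 2^τ W^τ`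
  have hW1 : 1 ≤ W := by
    rw [hW]
    have h3 : Real.log 3 ≤ Real.log (max 3 (Real.log (max y z : ℕ))) :=
      Real.log_le_log (by norm_num) (le_max_left _ _)
    have hl3 : 1 ≤ Real.log 3 := by
      rw [Real.le_log_iff_exp_le (by norm_num)]
      exact Real.exp_one_lt_d9.le.trans (by norm_num)
    linarith
  have h4 : Φ ≤ 2 ^ τ * W ^ τ := by
    rw [hΦ, ← mul_pow]
    apply pow_le_pow_left₀ (Real.log_nonneg (le_trans (by norm_num) (le_max_left _ _)))
    have hmax0 : 0 < max 3 (Real.log (max y z : ℕ)) := lt_of_lt_of_le (by norm_num) (le_max_left _ _)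
    have hle : max 3 (3 * Real.log (max y z : ℕ)) ≤ 3 * max 3 (Real.log (max y z : ℕ)) :=
      max_le (by linarith [le_max_left (3 : ℝ) (Real.log (max y z : ℕ))])
        (by linarith [le_max_right (3 : ℝ) (Real.log (max y z : ℕ))])
    calc Real.log (max 3 (3 * Real.log (max y z : ℕ)))
        ≤ Real.log (3 * max 3 (Real.log (max y z : ℕ))) :=
          Real.log_le_log (lt_of_lt_of_le (by norm_num) (le_max_left _ _)) hle
      _ = Real.log 3 + W := by rw [Real.log_mul (by norm_num) hmax0.ne', hW]
      _ ≤ 2 * W := by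
          have : Real.log 3 ≤ W := Real.log_le_log (by norm_num) (le_max_left _ _)
          linarith
  -- (5) `(4 L e^κ)ⁿ ≤ A P₁^{1/8}`
  have h5 : (4 * L * Real.exp κ) ^ n ≤ A * P₁ ^ (1 / 8 : ℝ) := hA S hprimeS
  -- (6) `Ψ ≤ C₁ P₁^{1/30}`
  have hC₁0 : 0 ≤ C₁ := by rw [hC₁]; positivity
  have h6 : Ψ ≤ C₁ * P₁ ^ (1 / 30 : ℝ) := by
    have hm1 : (1 : ℝ) ≤ max 3 P₁ := le_trans (by norm_num) (le_max_left _ _)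
    have hm0 : (0 : ℝ) ≤ max 3 P₁ := zero_le_one.trans hm1
    have hle : max 3 P₁ ≤ 3 * P₁ := max_le (by linarith) (by linarith)
    have h30 : (max 3 P₁) ^ (1 / 30 : ℝ) ≤ 3 * P₁ ^ (1 / 30 : ℝ) := by
      calc (max 3 P₁) ^ (1 / 30 : ℝ) ≤ (3 * P₁) ^ (1 / 30 : ℝ) :=
            Real.rpow_le_rpow hm0 hle (by norm_num)
        _ = (3 : ℝ) ^ (1 / 30 : ℝ) * P₁ ^ (1 / 30 : ℝ) :=
            Real.mul_rpow (by norm_num) (zero_le_one.trans hP₁1)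
        _ ≤ 3 * P₁ ^ (1 / 30 : ℝ) := by
            apply mul_le_mul_of_nonneg_right _ (Real.rpow_nonneg (zero_le_one.trans hP₁1) _)
            calc (3 : ℝ) ^ (1 / 30 : ℝ) ≤ (3 : ℝ) ^ (1 : ℝ) :=
                  Real.rpow_le_rpow_of_exponent_le (by norm_num) (by norm_num)
              _ = 3 := Real.rpow_one 3
    calc Ψ ≤ (30 * ((τ₁ : ℝ) + 1)) ^ τ₁ * (max 3 P₁) ^ (1 / 30 : ℝ) := log_pow_le_rpow τ₁ hm1
      _ ≤ (30 * ((τ₁ : ℝ) + 1)) ^ τ₁ * (3 * P₁ ^ (1 / 30 : ℝ)) :=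
          mul_le_mul_of_nonneg_left h30 (by positivity)
      _ = C₁ * P₁ ^ (1 / 30 : ℝ) := by rw [hC₁]; ring
  -- nonnegativity
  have hL0 : 0 ≤ L := zero_le_one.trans hL
  have hΘ0 : 0 ≤ Θ := Finset.prod_nonneg fun q hq =>
    Real.log_nonneg (by exact_mod_cast (hprimeS q hq).one_lt.le)
  have hΦ0 : 0 ≤ Φ := pow_nonneg (Real.log_nonneg (le_trans (by norm_num) (le_max_left _ _))) τ
  have hSg0 : 0 ≤ Sg := Finset.sum_nonneg fun p hp => mul_nonneg (Real.rpow_nonneg (Nat.cast_nonneg p) σ)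
    (Real.log_nonneg (by exact_mod_cast (hprimeT p hp).one_lt.le))
  have hΨ0 : 0 ≤ Ψ := pow_nonneg (Real.log_nonneg (le_trans (by norm_num) (le_max_left _ _))) τ₁
  have hnκ0 : 0 ≤ (n : ℝ) ^ (κ * n) := Real.rpow_nonneg (Nat.cast_nonneg n) _
  have hP₁0 : 0 < P₁ := by linarith
  have hP₂0 : 0 < P₂ := by linarith
  have hPx0 : 0 < Px := by linarith
  have hW0 : 0 ≤ W := by linarith
  -- assembling
  have hstep : K * L ^ n * (n : ℝ) ^ (κ * n) * Θ * Φ * Ψ * Sg ≤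
      K * L ^ n * (Real.exp κ ^ n * P₁ ^ κ) * (4 ^ n * P₁ ^ (1 / 4 : ℝ)) * (2 ^ τ * W ^ τ) *
        (C₁ * P₁ ^ (1 / 30 : ℝ)) * (8 * (P₂ ^ σ * P₂ ^ (1 / 8 : ℝ))) := by
    have hKL : 0 ≤ K * L ^ n := mul_nonneg hK (pow_nonneg hL0 n)
    apply mul_le_mul _ h3 hSg0 (by positivity)
    apply mul_le_mul _ h6 hΨ0 (by positivity)
    apply mul_le_mul _ h4 hΦ0 (by positivity)
    apply mul_le_mul _ h2 hΘ0 (by positivity)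
    exact mul_le_mul_of_nonneg_left h1 hKL
  have hpow₁ : P₁ ^ (1 / 8 : ℝ) * (P₁ ^ κ * P₁ ^ (1 / 4 : ℝ) * P₁ ^ (1 / 30 : ℝ)) ≤
      P₁ ^ (29 / 2 : ℝ) := by
    rw [← Real.rpow_add hP₁0, ← Real.rpow_add hP₁0, ← Real.rpow_add hP₁0]
    exact Real.rpow_le_rpow_of_exponent_le hP₁1 (by linarith)
  have hpow₂ : P₂ ^ σ * P₂ ^ (1 / 8 : ℝ) ≤ Px ^ (29 / 2 : ℝ) := by
    rw [← Real.rpow_add hP₂0]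
    exact (Real.rpow_le_rpow_of_exponent_le hP₂1 (by linarith)).trans
      (Real.rpow_le_rpow hP₂0.le hP₂x (by norm_num))
  calc ∑ p ∈ T, (x.factorization p : ℝ) * Real.log p
      ≤ K * L ^ n * (n : ℝ) ^ (κ * n) * Θ * Φ * Ψ * Sg := hsum
    _ ≤ K * L ^ n * (Real.exp κ ^ n * P₁ ^ κ) * (4 ^ n * P₁ ^ (1 / 4 : ℝ)) * (2 ^ τ * W ^ τ) *
        (C₁ * P₁ ^ (1 / 30 : ℝ)) * (8 * (P₂ ^ σ * P₂ ^ (1 / 8 : ℝ))) := hstep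
    _ = 8 * K * 2 ^ τ * C₁ * (4 * L * Real.exp κ) ^ n *
        (P₁ ^ κ * P₁ ^ (1 / 4 : ℝ) * P₁ ^ (1 / 30 : ℝ)) *
        (P₂ ^ σ * P₂ ^ (1 / 8 : ℝ)) * W ^ τ := by ring
    _ ≤ 8 * K * 2 ^ τ * C₁ * (A * P₁ ^ (1 / 8 : ℝ)) *
        (P₁ ^ κ * P₁ ^ (1 / 4 : ℝ) * P₁ ^ (1 / 30 : ℝ)) *
        (P₂ ^ σ * P₂ ^ (1 / 8 : ℝ)) * W ^ τ := by
        have h0 : 0 ≤ 8 * K * 2 ^ τ * C₁ := by positivity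
        have hrest : 0 ≤ (P₁ ^ κ * P₁ ^ (1 / 4 : ℝ) * P₁ ^ (1 / 30 : ℝ)) *
            (P₂ ^ σ * P₂ ^ (1 / 8 : ℝ)) * W ^ τ := by
          positivity
        calc 8 * K * 2 ^ τ * C₁ * (4 * L * Real.exp κ) ^ n *
              (P₁ ^ κ * P₁ ^ (1 / 4 : ℝ) * P₁ ^ (1 / 30 : ℝ)) *
              (P₂ ^ σ * P₂ ^ (1 / 8 : ℝ)) * W ^ τ
            = 8 * K * 2 ^ τ * C₁ * (4 * L * Real.exp κ) ^ n *
                ((P₁ ^ κ * P₁ ^ (1 / 4 : ℝ) * P₁ ^ (1 / 30 : ℝ)) *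
                  (P₂ ^ σ * P₂ ^ (1 / 8 : ℝ)) * W ^ τ) := by ring
          _ ≤ 8 * K * 2 ^ τ * C₁ * (A * P₁ ^ (1 / 8 : ℝ)) *
                ((P₁ ^ κ * P₁ ^ (1 / 4 : ℝ) * P₁ ^ (1 / 30 : ℝ)) *
                  (P₂ ^ σ * P₂ ^ (1 / 8 : ℝ)) * W ^ τ) :=
              mul_le_mul_of_nonneg_right (mul_le_mul_of_nonneg_left h5 h0) hrest
          _ = _ := by ring
    _ = 8 * K * 2 ^ τ * C₁ * A *
        (P₁ ^ (1 / 8 : ℝ) * (P₁ ^ κ * P₁ ^ (1 / 4 : ℝ) * P₁ ^ (1 / 30 : ℝ))) *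
        (P₂ ^ σ * P₂ ^ (1 / 8 : ℝ)) * W ^ τ := by ring
    _ ≤ 8 * K * 2 ^ τ * C₁ * A * P₁ ^ (29 / 2 : ℝ) * Px ^ (29 / 2 : ℝ) * W ^ τ := by
        have h0 : 0 ≤ 8 * K * 2 ^ τ * C₁ * A := by positivity
        have hWτ : 0 ≤ W ^ τ := pow_nonneg hW0 τ
        apply mul_le_mul_of_nonneg_right _ hWτ
        apply mul_le_mul _ hpow₂ (by positivity) (by positivity)
        exact mul_le_mul_of_nonneg_left hpow₁ h0
    _ = 8 * K * 2 ^ τ * C₁ * A * (Px * P₁) ^ (29 / 2 : ℝ) * W ^ τ := by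
        rw [Real.mul_rpow hPx0.le hP₁0.le]; ring
    _ = _ := by rw [hRad]

end StewartTijdemanGeneric

open StewartTijdemanGeneric

/-! ### The shape `(15, 0)` from a `p`-adic bound with a radical-logarithm factor -/

/-- **Stewart–Tijdeman 1986 (`log c ≤ κ R^{15}`) from ANY `p`-adic bound of classical quality for
linear forms in the logarithms of distinct primes, a polylogarithm of the product of the generators
being allowed** (the maximally permissive form of `stewartTijdeman1986_of_primePadicBound`, which is the
case `τ₁ = 0`). Hypothesis `hP`: for every prime `p`, all
distinct primes `q₁, …, qₙ ≠ p` and all `e ∈ ℤⁿ ∖ {0}` (so that `q₁^{e₁}⋯qₙ^{eₙ} ≠ 1`),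
`ord_p(q₁^{e₁}⋯qₙ^{eₙ} − 1) ≤ K · Lⁿ · n^{κn} · p^σ · (log q₁ ⋯ log qₙ) · (log max(3, max |eᵢ|))^τ ·
(log max(3, q₁⋯qₙ))^{τ₁}` with constants `K ≥ 0`, `L ≥ 1`, `τ, τ₁ ∈ ℕ` and `κ, σ ∈ [0, 14]` — so a
bound of the shape `C(n) p^σ Ω log Ω (log B + log Ω)^k` (`Ω = ∏ log qᵢ`; Baker's method with a
Kummer descent and no multiplicity estimate, e.g. the `p`-adic analogue of Cijsouw–Waldschmidt 1977,
Prop. 1, or Yu 1989/1990) qualifies, since `log Ω ≤ log(q₁⋯qₙ)`. Conclusion: the named fact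
`stewartTijdeman1986_upperBound` (`BakerShapeBound 15 0`) [cite: StewartTijdeman1986, Theorem 1
(upper bound), as quoted in Waldschmidt2014 §2 (PDF p. 3)].

This is the architecture of the 1986 proof with the `p`-adic input left generic: van der
Poorten's estimate as used in 1986 (`(16(n+1)d)^{12(n+1)} (p^d/log p) Ω (log B)²`,
[cite: ShoreyTijdeman1986, Ch. B, Theorem B.3 (PDF p. 38 of the held copy)], explicit
constants from van der Poorten 1977) is of this shape with `κ = 12`, `σ = 1`, `τ = 2`; Yu's
theorem has `(κ, σ) = (0, 1)` in Evertse–Győry's form (Thm 3.2.7, Yu 2007) and `(1, 1)` in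
Stewart's form (Stewart 2013, Lemma 3.1, Yu 2013; `primePadicBound_five_of_stewart2013Lemma5`).
Proof: `sum_padicPart_le_rad_logRad` at `x = c`,
`{y, z} = {a, b}` with `p₀ = 0` (`log c = ∑_{p ∣ c} ord_p(c) log p`), then
`bakerShapeBound_fifteen_of_loglog`. No archimedean estimate is used. -/
theorem stewartTijdeman1986_of_primePadicBound_logRad {K L κ σ : ℝ} {τ τ₁ : ℕ} (hK : 0 ≤ K)
    (hL : 1 ≤ L)
    (hκ0 : 0 ≤ κ) (hκ : κ ≤ 14) (hσ0 : 0 ≤ σ) (hσ : σ ≤ 14)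
    (hP : ∀ (p n : ℕ) (q : Fin n → ℕ) (e : Fin n → ℤ), p.Prime →
      (∀ i, (q i).Prime) → Function.Injective q → (∀ i, q i ≠ p) → e ≠ 0 →
      ∏ i, ((q i : ℚ)) ^ e i ≠ 1 →
      (padicValRat p (∏ i, ((q i : ℚ)) ^ e i - 1) : ℝ) ≤
        K * L ^ n * (n : ℝ) ^ (κ * n) * (p : ℝ) ^ σ * (∏ i, Real.log (q i)) *
          Real.log (max 3 ((Finset.univ.sup fun i => (e i).natAbs : ℕ) : ℝ)) ^ τ *
          Real.log (max 3 (∏ i, ((q i : ℕ) : ℝ))) ^ τ₁) :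
    stewartTijdeman1986_upperBound := by
  classical
  obtain ⟨A, hA1, hA⟩ := exists_pow_card_le_prod_rpow (C := 4 * L * Real.exp κ)
    (by nlinarith [Real.one_le_exp hκ0, hL]) (by norm_num : (0 : ℝ) < 1 / 8)
  have hA0 : 0 ≤ A := zero_le_one.trans hA1
  set C₁ : ℝ := 3 * (30 * ((τ₁ : ℝ) + 1)) ^ τ₁ with hC₁
  have hC₁0 : 0 ≤ C₁ := by rw [hC₁]; positivity
  have hM0 : 0 ≤ 8 * K * 2 ^ τ * C₁ * A := by positivity
  refine bakerShapeBound_fifteen_of_loglog (μ := 29 / 2) (τ := τ) (M := 8 * K * 2 ^ τ * C₁ * A + 1)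
    (by norm_num) le_rfl (by positivity) fun a b c ht => ?_
  have hP' : ∀ (p n : ℕ) (q : Fin n → ℕ) (e : Fin n → ℤ), p.Prime → 0 ≤ p →
      (∀ i, (q i).Prime) → Function.Injective q → (∀ i, q i ≠ p) → e ≠ 0 →
      ∏ i, ((q i : ℚ)) ^ e i ≠ 1 →
      (padicValRat p (∏ i, ((q i : ℚ)) ^ e i - 1) : ℝ) ≤
        K * L ^ n * (n : ℝ) ^ (κ * n) * (p : ℝ) ^ σ * (∏ i, Real.log (q i)) *
          Real.log (max 3 ((Finset.univ.sup fun i => (e i).natAbs : ℕ) : ℝ)) ^ τ *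
          Real.log (max 3 (∏ i, ((q i : ℕ) : ℝ))) ^ τ₁ :=
    fun p n q e hp _ => hP p n q e hp
  obtain ⟨ha, hb, habc, hcop⟩ := ht
  have hc0 : c ≠ 0 := by omega
  have hR1 : (1 : ℝ) ≤ (rad a b c : ℝ) := one_le_rad_real a b c
  have hRμ : (1 : ℝ) ≤ (rad a b c : ℝ) ^ (29 / 2 : ℝ) := Real.one_le_rpow hR1 (by norm_num)
  set Y : ℝ := Real.log (max 3 (Real.log c)) with hY
  have hl3 : 1 ≤ Real.log 3 := by
    rw [Real.le_log_iff_exp_le (by norm_num)]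
    exact Real.exp_one_lt_d9.le.trans (by norm_num)
  have hY1 : 1 ≤ Y := hl3.trans (Real.log_le_log (by norm_num) (le_max_left _ _))
  have hYτ : 1 ≤ Y ^ τ := one_le_pow₀ hY1
  rcases eq_or_ne a b with rfl | hab
  · -- `a = b = 1`, `c = 2`
    have ha1 : a = 1 := Nat.Coprime.eq_one_of_dvd hcop (dvd_refl a)
    have hc2 : c = 2 := by omega
    subst hc2
    have h2 : Real.log ((2 : ℕ) : ℝ) ≤ 1 := by
      push_cast; linarith only [Real.log_two_lt_d9]
    calc Real.log ((2 : ℕ) : ℝ) ≤ 1 := h2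
      _ ≤ (8 * K * 2 ^ τ * C₁ * A + 1) * (rad a a 2 : ℝ) ^ (29 / 2 : ℝ) * Y ^ τ := by
          have h1 : (1 : ℝ) ≤ 8 * K * 2 ^ τ * C₁ * A + 1 := by linarith
          calc (1 : ℝ) = 1 * 1 * 1 := by ring
            _ ≤ (8 * K * 2 ^ τ * C₁ * A + 1) * (rad a a 2 : ℝ) ^ (29 / 2 : ℝ) * Y ^ τ :=
                mul_le_mul (mul_le_mul h1 hRμ zero_le_one (by positivity)) hYτ zero_le_one
                  (by positivity)
  · -- the generic case: expand `c`
    have hcopc : Nat.Coprime c (a * b) := by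
      have hac : Nat.Coprime a c := by rw [← habc]; exact Nat.coprime_self_add_right.mpr hcop
      have hbc : Nat.Coprime b c := by rw [← habc]; exact Nat.coprime_add_self_right.mpr hcop.symm
      exact (Nat.Coprime.mul_left hac hbc).symm
    have hdvd : (c : ℤ) ∣ (a : ℤ) ^ 2 - (b : ℤ) ^ 2 :=
      ⟨(a : ℤ) - b, by rw [← habc]; push_cast; ring⟩
    have hmem := sum_padicPart_le_rad_logRad (p₀ := 0) hK hL hκ0 hκ hσ0 hσ hP' hA0 hA
      (by omega) ha hb hab hcop hcopc hdvd
    -- the left-hand side is `log c`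
    have hfilter : c.primeFactors.filter (fun p => 0 ≤ p) = c.primeFactors :=
      Finset.filter_true_of_mem fun p _ => Nat.zero_le p
    have hlogc : Real.log c = ∑ p ∈ c.primeFactors, (c.factorization p : ℝ) * Real.log p := by
      have h1 := Nat.prod_primeFactors_pow_factorization hc0
      have h2 : (c : ℝ) = ∏ p ∈ c.primeFactors, (p : ℝ) ^ c.factorization p := by
        exact_mod_cast h1
      rw [h2, Real.log_prod]
      · exact Finset.sum_congr rfl fun p _ => Real.log_pow _ _
      · intro p hp
        exact pow_ne_zero _ (by exact_mod_cast (Nat.prime_of_mem_primeFactors hp).ne_zero)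
    rw [hfilter, ← hlogc] at hmem
    -- the radical and the logarithms
    have hrad : (((∏ q ∈ (c * (a * b)).primeFactors, q : ℕ)) : ℝ) = (rad a b c : ℝ) := by
      rw [rad_def, Nat.radical_eq_prod_primeFactors, show c * (a * b) = a * b * c by ring]
    have hmaxc : Real.log (max a b : ℕ) ≤ Real.log c :=
      Real.log_le_log (by exact_mod_cast lt_max_of_lt_left ha)
        (by exact_mod_cast (max_le (by omega) (by omega) : max a b ≤ c))
    have hW : Real.log (max 3 (Real.log (max a b : ℕ))) ^ τ ≤ Y ^ τ := by
      apply pow_le_pow_left₀ (Real.log_nonneg (le_trans (by norm_num) (le_max_left _ _)))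
      exact Real.log_le_log (lt_of_lt_of_le (by norm_num) (le_max_left _ _))
        (max_le_max le_rfl hmaxc)
    rw [hrad] at hmem
    calc Real.log c ≤ 8 * K * 2 ^ τ * C₁ * A * (rad a b c : ℝ) ^ (29 / 2 : ℝ) *
          Real.log (max 3 (Real.log (max a b : ℕ))) ^ τ := hmem
      _ ≤ 8 * K * 2 ^ τ * C₁ * A * (rad a b c : ℝ) ^ (29 / 2 : ℝ) * Y ^ τ :=
          mul_le_mul_of_nonneg_left hW (by positivity)
      _ ≤ (8 * K * 2 ^ τ * C₁ * A + 1) * (rad a b c : ℝ) ^ (29 / 2 : ℝ) * Y ^ τ := by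
          apply mul_le_mul_of_nonneg_right _ (by positivity)
          apply mul_le_mul_of_nonneg_right _ (by positivity)
          linarith

end Literature.Barriers.ABC

end
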